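import Mathlib.NumberTheory.Padics.Complex
import Mathlib.Topology.Algebra.Valued.ValuationTopology
import Mathlib.LinearAlgebra.Matrix.Charpoly.Coeff
import Mathlib.LinearAlgebra.Matrix.GeneralLinearGroup.Defs
import Mathlib.LinearAlgebra.Matrix.NonsingularInverse
import HarnessLib

/-!
# Route `PhantomRMYoshida`, crux `ResiduallyYoshidaLifting` (stmt-Langlands-13639), line `sector-klingen-split`:
# stub T8c `stub_lagrangianQuotientCharpoly` — the Lagrangian block relation read residually

The registered sub-goal `stub_lagrangianQuotientCharpoly` of the checked skeleton `Lines/sector_klingen_split.lean` (rev 8, lead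
c4-0).  Notation: `ℤ̄_p := Valued.integer (PadicAlgCl p) ⊂ ℚ̄_p := PadicAlgCl p`, `red : ℤ̄_p → k` any ring map to a field.
For `T ∈ GL₂(ℤ̄_p)`, `τ' ∈ M₂(ℤ̄_p)`, `ν ∈ ℤ̄_p` and `X ∈ GL₂(ℚ̄_p)` (NOT assumed integral) with the Lagrangian block relation
`Tᵀ X τ' = ν X` over `ℚ̄_p`, the residual characteristic polynomials agree: `charpoly (red τ') = charpoly (red ν · (red T)ᵀ⁻¹)`.

Proof.
* Over `ℚ̄_p`: `Tᵀ` and `X` are invertible, so `τ' = X⁻¹ Tᵀ⁻¹ (ν X)` and, the characteristic polynomial being a conjugation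
  invariant (`Matrix.charpoly_mul_comm`), `charpoly τ' = charpoly (ν Tᵀ⁻¹)` in `ℚ̄_p[X]` (`charpoly_eq_of_mul_mul_eq_smul`).
* The right-hand side has the INTEGRAL lift `S := ν · (T⁻¹)ᵀ ∈ M₂(ℤ̄_p)` (`T⁻¹` the inverse in `GL₂(ℤ̄_p)`): for every ring map
  `f` out of `ℤ̄_p`, `f(S) = f(ν) · (f T)ᵀ⁻¹` (`map_smul_inv_val_transpose`: `GL₂(f)` is a group homomorphism, `Matrix.coe_units_inv`,
  `Matrix.transpose_nonsing_inv`).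
* The characteristic polynomial commutes with ring maps (`Matrix.charpoly_map`) and `ℤ̄_p[X] → ℚ̄_p[X]` is injective
  (`Polynomial.map_injective`), so `charpoly τ' = charpoly S` in `ℤ̄_p[X]`; applying `red` gives the claim.

References: none beyond Mathlib (linear algebra over a subring of a field).  No new definitions; helper lemmas are private.
-/

noncomputable section

-- `Summit.Langlands.Langlands.…` (summit = sub-problem name, D-0017 layout) trips `dupNamespace` on every decl;
-- project-wide option (lakefile `weak.linter.dupNamespace = false`).
set_option linter.dupNamespace false
set_option autoImplicit false

open scoped Matrix

namespace Summit.Langlands.Langlands.Cruxes.ResiduallyYoshidaLifting.SectorKlingenSplit.Fibre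

/-! ### Two pieces of matrix bookkeeping over commutative rings -/

/-- For an invertible matrix `T` over a commutative ring `O`, a scalar `ν ∈ O` and a ring map `f : O → L`, the image of the
matrix `ν · (T⁻¹)ᵀ` is `f(ν) · (f T)ᵀ⁻¹`, the latter inverse being the nonsingular inverse over `L` (`GLₙ(f)` is a group
homomorphism; `Matrix.coe_units_inv`, `Matrix.transpose_nonsing_inv`). [folklore] -/
private theorem map_smul_inv_val_transpose {O L : Type*} [CommRing O] [CommRing L] {n : Type*} [Fintype n]
    [DecidableEq n] (f : O →+* L) (T : GL n O) (ν : O) :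
    (ν • (T⁻¹).valᵀ).map f = f ν • ((Matrix.GeneralLinearGroup.map f T).val)ᵀ⁻¹ := by
  rw [Matrix.map_smul' _ _ _ (map_mul f), Matrix.transpose_map, ← Matrix.transpose_nonsing_inv,
    ← Matrix.coe_units_inv, ← map_inv]
  rfl

/-- **Conjugation invariance of the characteristic polynomial, Lagrangian form.**  If `A X B = ν X` for square matrices over
a commutative ring with `det A`, `det X` units, then `B = X⁻¹ (ν A⁻¹) X` and `charpoly B = charpoly (ν A⁻¹)`
(`Matrix.charpoly_mul_comm`). [folklore] -/
private theorem charpoly_eq_of_mul_mul_eq_smul {L : Type*} [CommRing L] {n : Type*} [Fintype n] [DecidableEq n]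
    {A X B : Matrix n n L} (ν : L) (hA : IsUnit A.det) (hX : IsUnit X.det) (h : A * X * B = ν • X) :
    B.charpoly = (ν • A⁻¹).charpoly := by
  have hB : B = X⁻¹ * (A⁻¹ * (ν • X)) := by
    rw [← h, Matrix.mul_assoc, Matrix.nonsing_inv_mul_cancel_left A _ hA, Matrix.nonsing_inv_mul_cancel_left X _ hX]
  rw [hB, Matrix.charpoly_mul_comm, Matrix.mul_smul, Matrix.smul_mul, Matrix.mul_nonsing_inv_cancel_right X _ hX]

/-! ### The registered stub -/

/-- **Stub T8c `stub_lagrangianQuotientCharpoly` (the Lagrangian relation read residually).**  If `Tᵀ X τ' = ν X` over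
`ℚ̄_p` with `T ∈ GL₂(ℤ̄_p)`, `τ'` integral, `ν ∈ ℤ̄_p` and `X ∈ GL₂(ℚ̄_p)` (NOT assumed integral), then `τ' = X⁻¹ (ν Tᵀ⁻¹) X`,
so the INTEGRAL polynomials `charpoly τ'` and `charpoly (ν T⁻¹ᵀ)` agree in `ℤ̄_p[X]` (they agree in `ℚ̄_p[X]`, and
`ℤ̄_p[X] → ℚ̄_p[X]` is injective), hence so do their reductions through `red`:
`charpoly (red τ') = charpoly (red ν · (red T)ᵀ⁻¹)`. [folklore] -/
theorem stub_lagrangianQuotientCharpoly :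
    ∀ (p : ℕ) [Fact p.Prime] (k : Type) [Field k] (red : Valued.integer (PadicAlgCl p) →+* k)
      (T : GL (Fin 2) (Valued.integer (PadicAlgCl p))) (τ' : Matrix (Fin 2) (Fin 2) (Valued.integer (PadicAlgCl p)))
      (X : Matrix (Fin 2) (Fin 2) (PadicAlgCl p)) (ν : Valued.integer (PadicAlgCl p)),
      IsUnit X.det →
      (Matrix.GeneralLinearGroup.map (Valued.integer (PadicAlgCl p)).subtype T).valᵀ * X *
          τ'.map (Valued.integer (PadicAlgCl p)).subtype = ((ν : Valued.integer (PadicAlgCl p)) : PadicAlgCl p) • X →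
      (τ'.map red).charpoly = ((red ν) • ((Matrix.GeneralLinearGroup.map red T).val)ᵀ⁻¹).charpoly := by
  intro p _ k _ red T τ' X ν hX hrel
  -- the integral identity `charpoly τ' = charpoly (ν • T⁻¹ᵀ)` in `ℤ̄_p[X]`, checked in `ℚ̄_p[X]`
  have hS : τ'.charpoly = (ν • (T⁻¹).valᵀ).charpoly := by
    apply Polynomial.map_injective (Valued.integer (PadicAlgCl p)).subtype Subtype.val_injective
    rw [← Matrix.charpoly_map, ← Matrix.charpoly_map, map_smul_inv_val_transpose]
    exact charpoly_eq_of_mul_mul_eq_smul _ (Matrix.isUnit_det_transpose _ (Matrix.isUnits_det_units _)) hX hrel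
  rw [Matrix.charpoly_map, hS, ← Matrix.charpoly_map, map_smul_inv_val_transpose]

end Summit.Langlands.Langlands.Cruxes.ResiduallyYoshidaLifting.SectorKlingenSplit.Fibre
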